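import Literature.AlgebraicGeometry.Resolution.ArithmeticalThreefoldsLocalEtaleClimb
import Literature.AlgebraicGeometry.Resolution.KrullRamificationHenselRoots
import HarnessLib

/-!
# Cossart–Piltant's unramified ascent `(LU v₀) ⇒ (LU v₀ⁱ)`, modulo cofinality of local uniformizations

Topic: `Literature/AlgebraicGeometry/Resolution`. PROOF side of `CossartPiltant2019ReductionP`
(`ArithmeticalThreefoldsLocal.lean`): the first two links `(LU v₀) ⇒ (LU v₀^Z) ⇒ (LU v₀ⁱ)` of
the chain in the proof of Cossart–Piltant 2019, Prop. 4.10 (arXiv v1 Prop. 4.8, p. 54: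
"`(LU v₀ⁱ)` holds by proposition 4.9 (1) as in [CoP1] corollary 7.3"), assembled from

* `KrullRamificationHenselRoots.lean`: the decomposition field `N^{G_Z}` is `M(η)` and the
  inertia field `N^{G_T}` is `N^{G_Z}(η′)` for henselian elements `η, η′` (roots of monic
  polynomials over the valuation rings of `M`, resp. `N^{G_Z}`, with unit derivative), and
* `ArithmeticalThreefoldsLocalEtaleClimb.lean`: climbing data ascend along a henselian element
  whose minimal equation has coefficients in the local ring of the model (étale over regular is
  regular — [CoP1] Cor. 7.3: "`R′` is local-étale over `R` … Then `R′` is regular, since `R`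
  is"),

under the hypothesis of COFINALITY OF LOCAL UNIFORMIZATIONS ([CoP1] Cor. 4.6: "for any local
model `R₀` of `V/k`, there exists a local uniformization `R₁` of `V/k` such that `R₀ < R₁`",
there derived from principalization, [CoP1] Prop. 4.2 = Cossart–Piltant 2019 Prop. 4.4,
`CossartPiltant2019Principalization`, by which the source puts the coefficients of the minimal
equation into the local uniformization: "by proposition 4.4, it can be assumed that `fᵢ ∈ Tʳ`").
Cofinality enters as an explicit hypothesis on the valued field `(Ω, O_Ω)` over `S` at the two
subfields `M` and `N^{G_Z}`: every model regular at the centre can be replaced by one whose local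
ring contains finitely many given elements of the valuation ring.

* `exists_model_of_henselRoot_of_cofinal` — PROVED: one link: climbing data at `M`, cofinality
  at `M`, and a henselian element `η ∈ O_Ω` over `O_Ω ∩ M` give climbing data at `M(η)`.
* `exists_model_inertiaField_of_cofinal` — PROVED: **`(LU v₀) ⇒ (LU v₀ⁱ)`**: climbing data at
  `M` and cofinality at `M` and at `N^{G_Z}` give climbing data at the inertia field `N^{G_T}`
  of `O_Ω ∩ N`, for `N | M` finite Galois inside `Ω`.

Everything is PROVED; no named facts are introduced; the local theorem is not used.

## Sources

* V. Cossart, O. Piltant, J. Algebra 529 (2019) 268–535 = arXiv:1412.0868, proof of Prop. 4.10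
  (arXiv v1: Prop. 4.8, p. 54). [CossartPiltant2019]
* V. Cossart, O. Piltant, J. Algebra 320 (2008) 1051–1082, Cor. 4.6 and Cor. 7.3 (HAL
  hal-00139124: Cor. 4.6 p. 14, Cor. 6.3 p. 18). [CossartPiltant2008]
-/

noncomputable section

open IsLocalRing Polynomial IntermediateField

namespace Literature.AlgebraicGeometry.Resolution

universe u

variable {S Ω : Type u} [CommRing S] [Field Ω] [Algebra S Ω] (OΩ : ValuationSubring Ω)

/-- **One link of the unramified ascent**: climbing data at a subfield `M` of the ambient valued
field `(Ω, O_Ω)` (a model `S[t] ⊆ O_Ω`, `t ⊆ M ⊆ Frac(S)(t)`, regular at the centre),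
cofinality of such models at `M` (every one can be replaced by one whose local ring at the
centre contains finitely many given elements of `O_Ω ∩ M`; [CoP1] Cor. 4.6), and a henselian
element `η ∈ O_Ω` over `O_Ω ∩ M` (a root of a monic `F` with coefficients in `O_Ω ∩ M` and
`v(F'(η)) = 0`) give climbing data at `M(η)` (`exists_model_adjoin_of_henselRoot`).
[cite: CossartPiltant2019, proof of Prop. 4.10 (arXiv v1: Prop. 4.8, p. 54)]
[cite: CossartPiltant2008, Cor. 4.6, Cor. 7.3 (HAL: Cor. 4.6, Cor. 6.3)] -/
theorem exists_model_of_henselRoot_of_cofinal (M : Subfield Ω)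
    (hcof : ∀ (t : Finset Ω), (t : Set Ω) ⊆ M →
      M ≤ Subfield.closure (Set.range (algebraMap S Ω) ∪ (t : Set Ω)) →
      ∀ (hTO : (Algebra.adjoin S (t : Set Ω)).toSubring ≤ OΩ.toSubring),
      IsRegularLocalRing (Localization.AtPrime
        (Ideal.comap (Subring.inclusion hTO) (maximalIdeal OΩ))) →
      ∀ (c : Finset Ω), (c : Set Ω) ⊆ M → (∀ x ∈ c, x ∈ OΩ) →
      ∃ t' : Finset Ω, (t' : Set Ω) ⊆ M ∧
        M ≤ Subfield.closure (Set.range (algebraMap S Ω) ∪ (t' : Set Ω)) ∧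
        ∃ hTO' : (Algebra.adjoin S (t' : Set Ω)).toSubring ≤ OΩ.toSubring,
          IsRegularLocalRing (Localization.AtPrime
            (Ideal.comap (Subring.inclusion hTO') (maximalIdeal OΩ))) ∧
          ∀ x ∈ c, ∃ a s : Ω, a ∈ Algebra.adjoin S (t' : Set Ω) ∧
            s ∈ Algebra.adjoin S (t' : Set Ω) ∧ OΩ.valuation s = 1 ∧ x * s = a)
    (hINV : ∃ t : Finset Ω, (t : Set Ω) ⊆ M ∧
      M ≤ Subfield.closure (Set.range (algebraMap S Ω) ∪ (t : Set Ω)) ∧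
      ∃ hTO : (Algebra.adjoin S (t : Set Ω)).toSubring ≤ OΩ.toSubring,
        IsRegularLocalRing (Localization.AtPrime
          (Ideal.comap (Subring.inclusion hTO) (maximalIdeal OΩ))))
    (η : Ω) (hη : η ∈ OΩ) (F : Polynomial Ω) (hFmon : F.Monic)
    (hFcoeff : ∀ k, F.coeff k ∈ OΩ ∧ F.coeff k ∈ M) (hFη : F.eval η = 0)
    (hF' : OΩ.valuation ((derivative F).eval η) = 1) :
    ∃ t' : Finset Ω,
      (t' : Set Ω) ⊆ (IntermediateField.adjoin M ({η} : Set Ω)).toSubfield ∧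
      (IntermediateField.adjoin M ({η} : Set Ω)).toSubfield ≤
        Subfield.closure (Set.range (algebraMap S Ω) ∪ (t' : Set Ω)) ∧
      ∃ hTO' : (Algebra.adjoin S (t' : Set Ω)).toSubring ≤ OΩ.toSubring,
        IsRegularLocalRing (Localization.AtPrime
          (Ideal.comap (Subring.inclusion hTO') (maximalIdeal OΩ))) := by
  classical
  obtain ⟨t, htM, hMcl, hTO, hreg⟩ := hINV
  -- put the coefficients of `F` into the local ring of a finer model (cofinality)
  let c : Finset Ω := (Finset.range (F.natDegree + 1)).image F.coeff
  have hcM : (c : Set Ω) ⊆ M := by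
    intro x hx
    obtain ⟨k, -, rfl⟩ := Finset.mem_image.mp (Finset.mem_coe.mp hx)
    exact (hFcoeff k).2
  have hcO : ∀ x ∈ c, x ∈ OΩ := by
    intro x hx
    obtain ⟨k, -, rfl⟩ := Finset.mem_image.mp hx
    exact (hFcoeff k).1
  obtain ⟨t₁, ht₁M, hMcl₁, hTO₁, hreg₁, hrep⟩ := hcof t htM hMcl hTO hreg c hcM hcO
  have hcoef : ∀ i, ∃ a s : Ω, a ∈ Algebra.adjoin S (t₁ : Set Ω) ∧
      s ∈ Algebra.adjoin S (t₁ : Set Ω) ∧ OΩ.valuation s = 1 ∧ F.coeff i * s = a := by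
    intro i
    by_cases hi : i ≤ F.natDegree
    · exact hrep (F.coeff i) (Finset.mem_image.mpr ⟨i, Finset.mem_range.mpr (Nat.lt_succ_of_le hi), rfl⟩)
    · refine ⟨0, 1, zero_mem _, one_mem _, map_one _, ?_⟩
      rw [Polynomial.coeff_eq_zero_of_natDegree_lt (not_le.mp hi), zero_mul]
  exact exists_model_adjoin_of_henselRoot OΩ M t₁ ht₁M hMcl₁ hTO₁ hreg₁ η hη F hFmon hFη hF' hcoef

/-- **`(LU v₀) ⇒ (LU v₀ⁱ)` modulo cofinality** (Cossart–Piltant 2019, proof of Prop. 4.10: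
"`(LU v₀ⁱ)` holds by proposition 4.9 (1) as in [CoP1] corollary 7.3"). Setting: `S → Ω` into
an ambient valued field `(Ω, O_Ω)`, a subfield `M ∋ S`, and a finite Galois extension `N | M`
inside `Ω` with decomposition group `G_Z` and inertia group `G_T` of `O_Ω ∩ N`
(`KrullRamificationGroups.lean`). Hypotheses: climbing data at `M`, and cofinality of local
uniformizations ([CoP1] Cor. 4.6) at the two subfields `M` and `N^{G_Z}` of `Ω`. Conclusion:
climbing data at the inertia field `N^{G_T} ⊆ Ω`. Proof: climb `M → N^{G_Z} = M(η) → N^{G_T} =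
N^{G_Z}(η′)` along the henselian generators of `KrullRamificationHenselRoots.lean` by
`exists_model_of_henselRoot_of_cofinal`.
[cite: CossartPiltant2019, proof of Prop. 4.10 (arXiv v1: Prop. 4.8, p. 54)]
[cite: CossartPiltant2008, Cor. 7.3 (HAL: Cor. 6.3, p. 18)] -/
theorem exists_model_inertiaField_of_cofinal (M : Subfield Ω)
    (N : IntermediateField M Ω) [FiniteDimensional M N] [IsGalois M N]
    (hcof : ∀ M' : Subfield Ω,
      (M' = M ∨ M' = (lift (fixedField (decompositionGroupIn OΩ N))).toSubfield) →
      ∀ (t : Finset Ω), (t : Set Ω) ⊆ M' →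
      M' ≤ Subfield.closure (Set.range (algebraMap S Ω) ∪ (t : Set Ω)) →
      ∀ (hTO : (Algebra.adjoin S (t : Set Ω)).toSubring ≤ OΩ.toSubring),
      IsRegularLocalRing (Localization.AtPrime
        (Ideal.comap (Subring.inclusion hTO) (maximalIdeal OΩ))) →
      ∀ (c : Finset Ω), (c : Set Ω) ⊆ M' → (∀ x ∈ c, x ∈ OΩ) →
      ∃ t' : Finset Ω, (t' : Set Ω) ⊆ M' ∧
        M' ≤ Subfield.closure (Set.range (algebraMap S Ω) ∪ (t' : Set Ω)) ∧
        ∃ hTO' : (Algebra.adjoin S (t' : Set Ω)).toSubring ≤ OΩ.toSubring,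
          IsRegularLocalRing (Localization.AtPrime
            (Ideal.comap (Subring.inclusion hTO') (maximalIdeal OΩ))) ∧
          ∀ x ∈ c, ∃ a s : Ω, a ∈ Algebra.adjoin S (t' : Set Ω) ∧
            s ∈ Algebra.adjoin S (t' : Set Ω) ∧ OΩ.valuation s = 1 ∧ x * s = a)
    (hINV : ∃ t : Finset Ω, (t : Set Ω) ⊆ M ∧
      M ≤ Subfield.closure (Set.range (algebraMap S Ω) ∪ (t : Set Ω)) ∧
      ∃ hTO : (Algebra.adjoin S (t : Set Ω)).toSubring ≤ OΩ.toSubring,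
        IsRegularLocalRing (Localization.AtPrime
          (Ideal.comap (Subring.inclusion hTO) (maximalIdeal OΩ)))) :
    ∃ t : Finset Ω,
      (t : Set Ω) ⊆ (lift (fixedField (inertiaGroupIn OΩ N))).toSubfield ∧
      (lift (fixedField (inertiaGroupIn OΩ N))).toSubfield ≤
        Subfield.closure (Set.range (algebraMap S Ω) ∪ (t : Set Ω)) ∧
      ∃ hTO : (Algebra.adjoin S (t : Set Ω)).toSubring ≤ OΩ.toSubring,
        IsRegularLocalRing (Localization.AtPrime
          (Ideal.comap (Subring.inclusion hTO) (maximalIdeal OΩ))) := by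
  classical
  -- `M → N^{G_Z} = M(η)`
  obtain ⟨η, hηV, -, ⟨F, hFmon, hFcoeff, hFη, hF'⟩, hZeq⟩ :=
    exists_henselRoot_toSubfield_decompositionField_eq OΩ N
  have hINV_Z := exists_model_of_henselRoot_of_cofinal OΩ M (hcof M (Or.inl rfl)) hINV η hηV F
    hFmon hFcoeff hFη hF'
  rw [← hZeq] at hINV_Z
  -- `N^{G_Z} → N^{G_T} = N^{G_Z}(η′)`
  obtain ⟨η', hη'V, -, ⟨F', hF'mon, hF'coeff, hF'η, hF''⟩, hTeq⟩ :=
    exists_henselRoot_toSubfield_inertiaField_eq OΩ N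
  have hINV_T := exists_model_of_henselRoot_of_cofinal OΩ
    (lift (fixedField (decompositionGroupIn OΩ N))).toSubfield (hcof _ (Or.inr rfl)) hINV_Z η'
    hη'V F' hF'mon hF'coeff hF'η hF''
  rw [← hTeq] at hINV_T
  exact hINV_T

end Literature.AlgebraicGeometry.Resolution

end
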